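import Literature.MathematicalPhysics.QuantumFieldTheory.Balaban1983to89.Node00.DatumAvLayer
import Literature.MathematicalPhysics.QuantumFieldTheory.Balaban1983to89.Node00.Record12BgRowMixed
import Literature.MathematicalPhysics.QuantumFieldTheory.Balaban1983to89.T3DescentFibreTower

/-!
# K0⁶ ROW P11 — CONSTANT-DIRECTION CONFIGURATIONS: holonomies, Bałaban's (0.4) averaging, the averaged tower, and print's (7) rows
# (the kinematic half of the WRAP CERTIFICATE for the ∃-gauge edition of the [15]-fact)

Cell `pub-ymgap`, seat `pub-ymgap-dag-n21-c` g10 (R134 (a) N21 NE7c s1; K0 ROW P11 negative lane of record for the [15]-fact editions; INBOX INTENT-1 of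
2026-08-27 ≈13:30Z).  Filed `--kind proof --supports stmt-QuantumFields-20506 --as helper` (K0⁶ `Record13SepCoPRInhabited`; dag-lead WORDS-142).
[15] = [Balaban1985Variational], [I] = [Balaban1987RG1], [III] = [Balaban1988Convergent], [B7] = [Balaban1985Averaging].

WHAT THIS FILE PROVES (theorems only; no `def`: the configuration is displayed by the hypothesis `hU : ∀ b, U b = if b.dir = μ₀ then D else 1` —
«`U` is the constant group element `D` on every bond of direction `μ₀` and `1` on every other bond»; dag-n07-e g9's LOCATED-Δ2 witness class, INBOX l.19990).
§1 (any gauge group `G`, any torus `P`, any level `j`):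
* `plaqHol_constDir` — every plaquette variable of a constant-direction field is `1` (`D·1·D⁻¹·1` resp. `1·D·1·D⁻¹`).
* `holAt_walk_constDir` — the parallel transport along the lattice walk of ANY word `w` from any base site is `D ^ netDisp w μ₀` (the factors met are powers of the
  single element `D`, hence commute; induction on the word with `T4Continuum.holAt_cons` ∕ `netDisp_cons`).
* `loopHol_constDir` — hence every loop variable `U(Γ ∪ [x,x′] ∪ (−Γ′) ∪ (−c))` of [I] (0.4) is `1` (the loop words are CLOSED: `netDisp_loopWord`).
* `pathProd_constDir` ∕ `axialAvg_constDir` — the straight `L`-bond transporter of a coarse bond `c` is `D ^ L` if `c.dir = μ₀`, else `1` (`line c t` has direction `c.dir`).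
* ★ `avgFun_constDir` — for ANY small-loop average `ℰ` with `ℰ.E (1, …, 1) = 1` (the printed exp[mean log]: `T3DescentFibreTower.expMeanLogSU_E_one`; the trivial
  average: `rfl`), Bałaban's (0.4) block average of the constant-direction field `D` at level `j` IS the constant-direction field `D ^ L` at level `j + 1`
  («the averages of a constant commuting field are constant», dag-n07-e l.19990 — here for the tree's total (0.4) map `BlockAveraging.avgFun`, small-field guard met since
  every loop variable is `1`).
§2 (the torus family `F.P K` of record, `SU(N)`, the averaging of record `avOfRecord F N K j = blockAvg expMeanLogSU`):
* ★ `avgFamily_avOfRecord_constDir` — the averaged tower `M^j(U)` (`B15DeterminingSets.avgFamily`, `Averaging.iter`) of the constant-direction field `D` is, at level `j`,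
  the constant-direction field `D ^ (L ^ j)`.
* `plaqHol_avgFamily_constDir` ∕ `dist1_plaqHol_avgFamily_constDir` — every plaquette variable of every level of that tower is `1` (distance `0` from `1`).
* `mixedField_avgFamily_succ` (any `U`: print's (7) field of [15] p. 278 L26–33 built from two CONSECUTIVE levels `M^{m+1}(U)`, `M^m(U)` of an averaged tower is the level
  `M^{m+1}(U)` itself — both branches of `Sect2.mixedField` read the same bond variable) and `dist1_plaqHol_mixedField_avgFamily_constDir` (`= 0`).
* `wilsonAction4_constDir_le` — the Wilson action of a constant-direction field is `≤ 0` (every plaquette term vanishes).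
These are the (6)∕(7) rows the wrap certificate (companion `…K0VariationalThm1GaugeWrap`) feeds to node00-def-P11's `VariationalThm1GaugeRegSepTop7M`: the
constant-direction field has all plaquettes `1` at every level (class (6) at any `ε₀ > 0`, datum (7) at any `δ > 0`, Wilson action `0`), while its holonomy around a
torus cycle of direction `μ₀` is `D ^ (sitesPerDir 0)`.

HONEST FRAMING: lattice kinematics of the tree's own objects ([folklore] algebra about (0.4) and (7)); nothing of Bałaban asserted or refuted; K0⁶ neither
discharged nor refuted; N21 NOT discharged; counts unmoved (typed 28∕28 · discharged 5∕28); one finite `𝕋⁴` torus family at fixed `ε = L^{−K}`; not continuum ∕ OS ∕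
mass gap ∕ Clay.  THEOREMS ONLY: no `def`, `instance`, `notation`, `sorry`; standard axioms.
DEPENDENCES (by name, CITED not restated): `T4Continuum.walk ∕ holAt ∕ netDisp ∕ holAt_cons ∕ holAt_nil ∕ netDisp_cons`, `BlockAveraging.loopHol ∕ Small ∕ corr ∕ avgFun ∕
netDisp_loopWord`, `AveragingRT.pathProd ∕ axialAvg ∕ line`, `LoopAverage.avg`, ym3 `T3DescentFibreTower.expMeanLogSU_E_one`, NODE 00 `avOfRecord_avg`, r12∕def-P11
`Sect2.mixedField` (FILE 8 `Record12BgRowMixed`), r11 `B15DeterminingSets.avgFamily`, `Setup.Averaging.iter`, `GaugeField.plaqHol`, `Setup.wilsonAction4`.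
-/

noncomputable section

open scoped Matrix.Norms.L2Operator

namespace Summit.QuantumFields.YangMills.Theorems.K0ConstantDirectionTower

open Literature.MathematicalPhysics.QuantumFieldTheory.Balaban1983to89
open Literature.MathematicalPhysics.QuantumFieldTheory.Balaban1983to89.Node00
open Literature.MathematicalPhysics.QuantumFieldTheory.Balaban1983to89.T4Continuum
open Literature.MathematicalPhysics.QuantumFieldTheory.Balaban1983to89.AveragingRT
open Literature.MathematicalPhysics.QuantumFieldTheory.Balaban1983to89.BlockAveraging
open Literature.MathematicalPhysics.QuantumFieldTheory.Balaban1983to89.T3DescentFibreTower (expMeanLogSU_E_one)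
open ExpMeanLog (expMeanLogSU)
open B15DeterminingSets

/-! ## §1  Kinematics of a constant-direction field (any gauge group, any torus, any level) -/
section Kinematics

variable {P : Params} {j : ℕ} {G : Type*} [GaugeGroup G]

/-- **Every plaquette variable of a constant-direction field is `1`**: `U(∂p) = D·1·D⁻¹·1⁻¹` if `p.μ = μ₀`, `1·D·1⁻¹·D⁻¹` if `p.ν = μ₀`, `1` otherwise
(`p.μ < p.ν`, so at most one of them is `μ₀`). [cite: Balaban1985Averaging, (9) p.19 (bookkeeping: plaquette variables)] -/
theorem plaqHol_constDir (D : G) (μ₀ : Fin P.d) {U : GaugeField P j G} (hU : ∀ b, U b = if b.dir = μ₀ then D else 1) (p : Plaq P j) :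
    GaugeField.plaqHol U p = 1 := by
  have hne : p.μ ≠ p.ν := ne_of_lt p.hμν
  unfold GaugeField.plaqHol
  rw [hU, hU, hU, hU]
  dsimp only
  by_cases hμ : p.μ = μ₀
  · have hν : p.ν ≠ μ₀ := fun h => hne (hμ.trans h.symm)
    simp [hμ, hν]
  · by_cases hν : p.ν = μ₀
    · simp [hμ, hν]
    · simp [hμ, hν]

/-- Hence every plaquette variable of a constant-direction field is at distance `0` from `1`. [cite: Balaban1985Averaging, (9) p.19 (bookkeeping)] -/
theorem dist1_plaqHol_constDir (D : G) (μ₀ : Fin P.d) {U : GaugeField P j G} (hU : ∀ b, U b = if b.dir = μ₀ then D else 1) (p : Plaq P j) :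
    dist1 (GaugeField.plaqHol U p) = 0 := by
  rw [plaqHol_constDir D μ₀ hU, GaugeGroup.dist1_one]

/-- **PARALLEL TRANSPORT OF A CONSTANT-DIRECTION FIELD ALONG ANY LATTICE WALK** is `D ^ (net displacement of the word in direction μ₀)`: each letter `±e_{μ₀}` contributes
`D^{±1}`, every other letter `1`, and all factors are powers of `D`. [cite: Balaban1985Averaging, (8)–(9) p.18–19 (bookkeeping: transport along contours)] -/
theorem holAt_walk_constDir (D : G) (μ₀ : Fin P.d) {U : GaugeField P j G} (hU : ∀ b, U b = if b.dir = μ₀ then D else 1) :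
    ∀ (x : Site P j) (w : List (Letter P.d)), holAt U (walk x w) = D ^ netDisp w μ₀
  | _, [] => by simp [walk, holAt_nil, netDisp]
  | x, (μ, true) :: w => by
      show holAt U (⟨⟨x, μ⟩, true⟩ :: walk (x.shift μ) w) = _
      rw [holAt_cons, holAt_walk_constDir D μ₀ hU (x.shift μ) w, netDisp_cons, zpow_add, hU]
      dsimp only
      by_cases hμ : μ = μ₀
      · simp [hμ]
      · simp [hμ]
  | x, (μ, false) :: w => by
      show holAt U (⟨⟨x.unshift μ, μ⟩, false⟩ :: walk (x.unshift μ) w) = _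
      rw [holAt_cons, holAt_walk_constDir D μ₀ hU (x.unshift μ) w, netDisp_cons, zpow_add, hU]
      dsimp only
      by_cases hμ : μ = μ₀
      · simp [hμ]
      · simp [hμ]

/-- **EVERY LOOP VARIABLE OF [I] (0.4) OF A CONSTANT-DIRECTION FIELD IS `1`**: the loop words `Γ ∪ [x,x′] ∪ (−Γ′) ∪ (−c)` are closed (`netDisp_loopWord`).
[cite: Balaban1987RG1, (0.4) p.253] -/
theorem loopHol_constDir (D : G) (μ₀ : Fin P.d) {U : GaugeField P j G} (hU : ∀ b, U b = if b.dir = μ₀ then D else 1)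
    (c : PBond P (j + 1)) (i : Idx P) : loopHol U c i = 1 := by
  unfold loopHol
  rw [holAt_walk_constDir D μ₀ hU, netDisp_loopWord, zpow_zero]

/-- The partial straight-line transporters of a coarse bond `c`: `D ^ t` if `c.dir = μ₀`, else `1` (every bond `line c t` has direction `c.dir`).
[cite: Balaban1984PropagatorsI, (1.7) p.18 (bookkeeping)] -/
theorem pathProd_constDir (D : G) (μ₀ : Fin P.d) {U : GaugeField P j G} (hU : ∀ b, U b = if b.dir = μ₀ then D else 1)
    (c : PBond P (j + 1)) (t : ℕ) : pathProd U c t = if c.dir = μ₀ then D ^ t else 1 := by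
  induction t with
  | zero => simp [pathProd]
  | succ t ih =>
    rw [pathProd, ih, hU]
    show (if c.dir = μ₀ then D ^ t else 1) * (if c.dir = μ₀ then D else 1) = _
    by_cases h : c.dir = μ₀
    · simp [h, pow_succ]
    · simp [h]

/-- The axial (straight-line) average of a constant-direction field: `D ^ L` on direction `μ₀`, `1` elsewhere. [cite: Balaban1984PropagatorsI, (1.7) p.18 (bookkeeping)] -/
theorem axialAvg_constDir (D : G) (μ₀ : Fin P.d) {U : GaugeField P j G} (hU : ∀ b, U b = if b.dir = μ₀ then D else 1)
    (c : PBond P (j + 1)) : axialAvg U c = if c.dir = μ₀ then D ^ P.L else 1 :=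
  pathProd_constDir D μ₀ hU c P.L

/-- The constant-direction field is in the small-field domain of (0.4) at every coarse bond (all loop variables are `1`). [cite: Balaban1987RG1, (0.4) p.253 (bookkeeping)] -/
theorem small_constDir (ℰ : LoopAverage G) (D : G) (μ₀ : Fin P.d) {U : GaugeField P j G} (hU : ∀ b, U b = if b.dir = μ₀ then D else 1)
    (c : PBond P (j + 1)) : Small ℰ U c := fun i => by
  rw [loopHol_constDir D μ₀ hU, GaugeGroup.dist1_one]
  exact ℰ.δ_pos

/-- **★ BAŁABAN'S (0.4) AVERAGE OF A CONSTANT-DIRECTION FIELD IS THE CONSTANT-DIRECTION FIELD `D ^ L` ONE LEVEL UP**, for every small-loop average `ℰ` whose value on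
the constant family `1` is `1` (the printed exp[mean log]: `expMeanLogSU_E_one`): the correction factor `exp[…]` of (0.4) reads the family of loop variables, all equal
to `1`, and the coarse bond variable is the straight transporter `D ^ L` resp. `1`. [cite: Balaban1987RG1, (0.4) p.253] -/
theorem avgFun_constDir (ℰ : LoopAverage G) (hE : ∀ n : ℕ, ℰ.E (fun _ : Fin (n + 1) => (1 : G)) = 1)
    (D : G) (μ₀ : Fin P.d) {U : GaugeField P j G} (hU : ∀ b, U b = if b.dir = μ₀ then D else 1) :
    ∀ c : PBond P (j + 1), avgFun ℰ U c = if c.dir = μ₀ then D ^ P.L else 1 := by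
  intro c
  show corr ℰ U c * axialAvg U c = _
  have hl : loopHol U c = fun _ => 1 := funext (loopHol_constDir D μ₀ hU c)
  rw [corr, if_pos (small_constDir ℰ D μ₀ hU c), hl, axialAvg_constDir D μ₀ hU]
  have h1 : ℰ.avg (fun _ : Idx P => (1 : G)) = 1 := hE _
  rw [h1, one_mul]

end Kinematics

/-! ## §2  The averaged tower of record of a constant-direction field on `F.P K`, `SU(N)`; its (6)∕(7) rows -/
section Tower

variable {F : T4Family} {N : ℕ} [NeZero N]

/-- **★ THE AVERAGED TOWER OF A CONSTANT-DIRECTION FIELD**: with the averaging of record (`avOfRecord F N K j = blockAvg expMeanLogSU`), the level-`j` member of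
`avgFamily (avOfRecord F N K) U` is the constant-direction field `D ^ (L ^ j)`. [cite: Balaban1987RG1, (0.4) p.253; Balaban1988Convergent, (2.10) p.256 (bookkeeping: the averaged tower `M^j`)] -/
theorem avgFamily_avOfRecord_constDir (K : ℕ) (D : SU N) (μ₀ : Fin (F.P K).d) {U : GaugeField (F.P K) 0 (SU N)}
    (hU : ∀ b, U b = if b.dir = μ₀ then D else 1) :
    ∀ (j : ℕ) (b : PBond (F.P K) j), avgFamily (avOfRecord F N K) U j b = if b.dir = μ₀ then D ^ (F.L ^ j) else 1
  | 0, b => by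
      show U b = _
      rw [hU, pow_zero, pow_one]
  | j + 1, b => by
      show (avOfRecord F N K j).avg (avgFamily (avOfRecord F N K) U j) b = _
      rw [avOfRecord_avg]
      rw [avgFun_constDir expMeanLogSU expMeanLogSU_E_one (D ^ (F.L ^ j)) μ₀ (avgFamily_avOfRecord_constDir K D μ₀ hU j) b,
        T4Family.P_L, ← pow_mul, ← pow_succ]

/-- Every plaquette variable of every level of the averaged tower of a constant-direction field is `1`. [cite: Balaban1985Variational, (7) p.278 (bookkeeping: the plaquette variables the datum rows read)] -/
theorem plaqHol_avgFamily_constDir (K : ℕ) (D : SU N) (μ₀ : Fin (F.P K).d) {U : GaugeField (F.P K) 0 (SU N)}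
    (hU : ∀ b, U b = if b.dir = μ₀ then D else 1) (j : ℕ) (q : Plaq (F.P K) j) :
    GaugeField.plaqHol (avgFamily (avOfRecord F N K) U j) q = 1 :=
  plaqHol_constDir (D ^ (F.L ^ j)) μ₀ (avgFamily_avOfRecord_constDir K D μ₀ hU j) q

/-- … hence at distance `0` from `1`. [cite: Balaban1985Variational, (7) p.278 (bookkeeping)] -/
theorem dist1_plaqHol_avgFamily_constDir (K : ℕ) (D : SU N) (μ₀ : Fin (F.P K).d) {U : GaugeField (F.P K) 0 (SU N)}
    (hU : ∀ b, U b = if b.dir = μ₀ then D else 1) (j : ℕ) (q : Plaq (F.P K) j) :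
    dist1 (GaugeField.plaqHol (avgFamily (avOfRecord F N K) U j) q) = 0 := by
  rw [plaqHol_avgFamily_constDir K D μ₀ hU, GaugeGroup.dist1_one]

/-- **PRINT'S (7) FIELD OF TWO CONSECUTIVE LEVELS OF AN AVERAGED TOWER IS THE UPPER LEVEL** (any configuration `U`, any site set `S`): on the bonds of `Λ_{m+1}` it
reads `M^{m+1}(U)`, off them the one-step average of `M^m(U)` — the same field (`avgFamily … (m+1) = (av m).avg (avgFamily … m)` by construction).
[cite: Balaban1985Variational, (7) p.278 L26–33 (bookkeeping)] -/
theorem mixedField_avgFamily_succ {P : Params} {G : Type*} [GaugeGroup G] (av : ∀ i, Averaging P i G) (U : GaugeField P 0 G) {m : ℕ}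
    (S : Set (Site P (m + 1))) : Sect2.mixedField av S (avgFamily av U (m + 1)) (avgFamily av U m) = avgFamily av U (m + 1) := by
  funext b
  unfold Sect2.mixedField
  split_ifs <;> rfl

/-- Every plaquette variable of print's (7) field built from two consecutive levels of the averaged tower of a constant-direction field is at distance `0` from `1`.
[cite: Balaban1985Variational, (7) p.278 (bookkeeping)] -/
theorem dist1_plaqHol_mixedField_avgFamily_constDir (K : ℕ) (D : SU N) (μ₀ : Fin (F.P K).d) {U : GaugeField (F.P K) 0 (SU N)}
    (hU : ∀ b, U b = if b.dir = μ₀ then D else 1) {m : ℕ} (S : Set (Site (F.P K) (m + 1))) (q : Plaq (F.P K) (m + 1)) :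
    dist1 (GaugeField.plaqHol (Sect2.mixedField (avOfRecord F N K) S (avgFamily (avOfRecord F N K) U (m + 1)) (avgFamily (avOfRecord F N K) U m)) q) = 0 := by
  rw [mixedField_avgFamily_succ, dist1_plaqHol_avgFamily_constDir K D μ₀ hU]

/-- **THE WILSON ACTION OF A CONSTANT-DIRECTION FIELD IS `≤ 0`** (hence `0`, and minimal on any fibre): every plaquette term `1 − Re tr U(∂p)∕N` vanishes.
[cite: Balaban1985Variational, (5) p.278 (bookkeeping)] -/
theorem wilsonAction4_constDir_le {P : Params} (D : SU N) (μ₀ : Fin P.d) {U : GaugeField P 0 (SU N)} (hU : ∀ b, U b = if b.dir = μ₀ then D else 1) :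
    wilsonAction4 U ≤ 0 := by
  unfold wilsonAction4 wilsonAction
  refine Finset.sum_nonpos fun p _ => ?_
  rw [plaqHol_constDir D μ₀ hU, GaugeGroup.reTr_one]
  simp

end Tower

end Summit.QuantumFields.YangMills.Theorems.K0ConstantDirectionTower

end
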